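import Mathlib
import HarnessLib

/-!
# Normal form of a singular multiplicative derivation of a complete regular local ring (Posva)

Topic: `Literature/RingTheory/Derivation` (commutative algebra of `p`-closed derivations; companion
of `HochschildFormula`, `PClosedTaylor`). Source: Q. Posva, *On the singularities of quotients by
1-foliations*, Nagoya Math. J. **261** (2026) e6, 1–41, doi:10.1017/nmj.2025.10072 =
arXiv:2311.16694 (bib key `Posva2023`), §4.1 «Quotients by multiplicative derivations»,
**Proposition 4.1** (journal p. 23 L43–L52, proof p. 23 L53 – p. 24 L16; = arXiv v4/v5
Prop. 4.1.1). Conventions of the source: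
`k` is a field of characteristic `p > 0` (perfect, §2.1 p. 4 L15); `D^[p] = D ∘ ⋯ ∘ D` (§2.3 p. 5);
a `k`-derivation `D` of `A` is *multiplicative* if `D^[p] = u D` for a unit `u ∈ Aˣ`
(Definition 2.5, p. 7 L24–L26).

PRINTED STATEMENT (journal, p. 23, verbatim): «Proposition 4.1. Suppose that A a regular local
k-algebra. If D ∈ Der_k(A) is multiplicative then there exist formal coordinates x₁, …, x_d ∈ Â and
λ₁, …, λ_d ∈ 𝔽_p such that D = ∑ᵢ λᵢ xᵢ ∂/∂xᵢ. In particular, the completion of A^D is normal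
toric.» The author's post-publication revision arXiv:2311.16694v5 (25 Aug 2026), Prop. 4.1.1
p. 20, adds the hypothesis «D is singular» and the sentence «The assumption of singularity is
necessary, as shown by the multiplicative derivation (1+x)∂ₓ on k[x]_(x)»; the first posted version
(arXiv v1, Nov. 2023; held as corpus `paper:arxiv-2311.16694`, chunk p0015) stated it for «k
algebraically closed and A a regular local k-algebra with residue field k», with conclusion «the
completion of A^D is normal toric» and the normal form displayed inside the proof.

WHAT IS TYPED, AND HOW IT RELATES TO PRINT. The printed proof (p. 23 L5–L17, p. 24 L3–L16) does not
diagonalise `D` itself but the rescaled derivation `D' = λD`, `λ = u^{1/(1-p)}` (p. 23 L9–L10: the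
finite étale cover `A ↪ A' = A[λ = u^{1/(1-p)}]`; L15–L17: `(λD)^[p] = λD`, «the derivation
D′ = λD on A′ gives rise to a μ_p-group action»; p. 24 L3: «So we may assume that A is complete and
that D is given by a continuous μ_p-action»), and `A^D = A^{D'}`. The eigenvalues of the linear
part of `D` on `𝔪/𝔪²` are intrinsic, so for `D` itself the display can only hold up to the unit
`λ` (e.g. `D = a·x ∂ₓ` on `k⟦x⟧`, `a ∈ k ∖ 𝔽_p`, is singular and multiplicative with `u = a^{p-1}`,
and `λD = x∂ₓ` for `λ = a⁻¹`). We therefore type the normal form FOR `λD`, with `λ ^ (p-1) · u = 1`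
recorded, under the hypotheses the printed proof uses: `k` algebraically closed and residue field
`k` (arXiv v1; this is what makes the cover `A'/A` induce isomorphisms of residue fields and
completions, p. 23 L53–L55), `D` singular (arXiv v5), and — a harmless specialisation, see
`TODO` — `A` already complete (`= Â`; v5 p. 20 L41–L43 reduces to this case: a singular `D` is
`𝔪`-adically continuous and extends to `Â`). «Formal coordinates `x₁,…,x_d`» = a regular system of
parameters of the complete regular local ring `Â` (`(x₁,…,x_d) = 𝔪`, `d = dim A`), and
`λD = ∑ λᵢ xᵢ ∂/∂xᵢ` is recorded coordinatewise as `λ · D xᵢ = λᵢ xᵢ` (equivalent for the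
`𝔪`-adically continuous `k`-derivation `λD` of `k⟦x₁,…,x_d⟧`). The clause «the completion of A^D is
normal toric» is NOT typed (no definition of a toric complete local ring in the source or the tree).
-- TODO(general form): non-complete `A` (statement in `Â`); residue field `k(A) ⊋ k`.

CONTENTS (the printed proof, step by step; all proofs are inline, no named hypotheses):
* `exists_pow_eq_of_residue_pow` — Hensel's lemma in the complete local ring replaces the étale
  cover `A[u^{1/(1-p)}]` of p. 23 L9–L12: `u` has a `(p-1)`-st root `μ` as soon as its residue is a
  `(p-1)`-st power of a non-zero scalar (automatic for `k = k̄`); `λ := μ⁻¹`.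
* `apply_mul_apply_eq_zero_of_iterate_eq` — `D u · D(·) = 0` (the source cites [40, Lemma 2.3],
  Matsumoto, for `u ∈ A^D`; here: compare `D^[p+1]` computed as `D ∘ D^[p]` and `D^[p] ∘ D`), whence
  `D λ · D(·) = 0` and `iterate_smul_apply_of_apply_mul`: `(λD)^[n] = λⁿ D^[n]`, so
  `(λD)^[p] = λ^p u D = λD` (p. 23 L14–L16; Hochschild's formula (2.1) is not needed in this case).
* `proj`, `sum_proj`, `apply_proj` — the `μ_p`-action / `ℤ/p`-grading `A' = ⊕ A'_i`,
  `A'_i = {s | D′ s = i s}` (p. 23 L17–L25) is realised by the Lagrange interpolation projectors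
  `ℓ_j(T)`, `j ∈ 𝔽_p`, of the `k`-linear map `T = λD` with `T^p = T`: `∑_j ℓ_j(T) = 1` and
  `T ∘ ℓ_j(T) = j · ℓ_j(T)` because `(X - j) ℓ_j = w_j (X^p - X)` (`nodal_univ_node_eq`:
  `∏_{j ∈ 𝔽_p} (X - j) = X^p - X`). This is the «M^p = M, so M is semisimple with eigenvalues in
  𝔽_p» step of p. 24 L5–L8.
* `exists_regularParameters_eigen` — linearisation (p. 24 L3–L8, where the source cites the proof
  of [54, Cor. 1.8], Satriano): since `D` is singular the projectors preserve `𝔪`, so the images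
  of the eigen-elements `ℓ_j(T) b`, `b ∈ 𝔪`, span `𝔪/𝔪²`; a `κ(A)`-basis extracted from them lifts
  (Nakayama, `IsLocalRing.CotangentSpace.span_image_eq_top_iff`) to a regular system of parameters
  consisting of `T`-eigenvectors with eigenvalues in `𝔽_p`, `d = dim A` by regularity
  (`IsRegularLocalRing.iff_finrank_cotangentSpace`). This is the ROOT FORM (hypothesis: the residue
  of `u` is a `(p-1)`-st power in `k`), labelled OURS in its docstring.
* `Posva2023_Prop_4_1` — the named statement with the source's hypotheses (`k = k̄`, residue field
  `k`), and `Posva2023_Prop_4_1_holds` — its proof from the root form. No undischarged facts.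

References: [cite: Posva2023, Def. 2.5 p. 7, §4.1 pp. 23–24, Prop. 4.1 p. 23] (journal pagination,
Nagoya Math. J. 261 (2026) e6; open access CC-BY); arXiv:2311.16694v5 Prop. 4.1.1 p. 20 (the
«singular» hypothesis and its necessity); arXiv:2311.16694v1 §4.1 (hypotheses `k = k̄`, residue
field `k`). Background cited by the source at this point: [40] = Y. Matsumoto, Lemma 2.3
(`u ∈ A^D`); [53] = Rudakov–Šafarevič 1976, Thm 2; [54] = M. Satriano 2012, Cor. 1.8.
-/

noncomputable section

open IsLocalRing Polynomial Finset Module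

namespace Literature.RingTheory.Derivation

namespace MultiplicativeNormalForm

/-! ### Step 1 — Hensel: a `(p-1)`-st root of the unit `u` -/

section Hensel

variable {k R : Type*} [Field k] [CommRing R] [Algebra k R] [IsLocalRing R]
  [IsAdicComplete (maximalIdeal R) R]

/-- In a complete local `k`-algebra, an element `u` whose residue class is the `n`-th power of a
non-zero scalar `c : k`, with `n` invertible in `R`, has an `n`-th root (Hensel's lemma for
`X ^ n - u` at the simple approximate root `c`). [folklore] -/
private theorem exists_pow_eq_of_residue_pow {n : ℕ} (hn : 0 < n) (hnu : IsUnit (n : R)) {u : R}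
    {c : k} (hc : c ≠ 0) (hu : u - algebraMap k R (c ^ n) ∈ maximalIdeal R) :
    ∃ μ : R, μ ^ n = u := by
  have hH := (IsAdicComplete.henselianRing R (maximalIdeal R)).is_henselian
  have hmon : (X ^ n - C u : R[X]).Monic := monic_X_pow_sub_C u hn.ne'
  have hcu : IsUnit (algebraMap k R c) := hc.isUnit.map _
  obtain ⟨a, ha, -⟩ := hH (X ^ n - C u) hmon (algebraMap k R c) (by
      have : eval (algebraMap k R c) (X ^ n - C u) = -(u - algebraMap k R (c ^ n)) := by
        simp only [eval_sub, eval_pow, eval_X, eval_C, map_pow, neg_sub]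
      rw [this]
      exact neg_mem hu) (by
      have : eval (algebraMap k R c) (derivative (X ^ n - C u)) =
          (n : R) * algebraMap k R c ^ (n - 1) := by
        simp only [derivative_sub, derivative_X_pow, derivative_C, sub_zero, eval_mul, eval_C,
          eval_pow, eval_X]
      rw [this]
      exact (hnu.mul (hcu.pow _)).map _)
  refine ⟨a, ?_⟩
  have h := ha
  rwa [IsRoot.def, eval_sub, eval_pow, eval_X, eval_C, sub_eq_zero] at h

end Hensel

/-! ### Step 2 — rescaling a multiplicative derivation to a `p`-idempotent one -/

section Rescale

variable {k R : Type*} [CommRing k] [CommRing R] [Algebra k R]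

/-- If `D^[p] = u · D` then `D u · D a = 0` for every `a` (compute `D^[p+1] a` in two ways).
[cite: Posva2023, §4.1 p. 23 L6–L7 («By [40, Lemma 2.3] we have u ∈ A^D»)] -/
theorem apply_mul_apply_eq_zero_of_iterate_eq (D : _root_.Derivation k R R) {p : ℕ} {u : R}
    (hD : ∀ a, (⇑D)^[p] a = u * D a) (a : R) : D u * D a = 0 := by
  have h1 : (⇑D)^[p + 1] a = u * D (D a) + D a * D u := by
    rw [Function.iterate_succ_apply', hD, Derivation.leibniz, smul_eq_mul, smul_eq_mul]
  have h2 : (⇑D)^[p + 1] a = u * D (D a) := by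
    rw [Function.iterate_succ_apply, hD]
  have h3 : D a * D u = 0 := by
    have := h1.symm.trans h2
    rwa [add_eq_left] at this
  rwa [mul_comm] at h3

/-- If `D λ · D b = 0` for all `b`, then the iterates of the rescaled derivation `λ • D` are
`(λ • D)^[n] = λ ^ n · D^[n]`. [folklore] -/
private theorem iterate_smul_apply_of_apply_mul (D : _root_.Derivation k R R) {lam : R}
    (hlam : ∀ b, D lam * D b = 0) (n : ℕ) (a : R) :
    (⇑(lam • D))^[n] a = lam ^ n * (⇑D)^[n] a := by
  induction n with
  | zero => simp
  | succ n ih =>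
    have hz : (⇑D)^[n] a * D (lam ^ n) = 0 := by
      cases n with
      | zero => simp
      | succ m =>
        have h0 := hlam ((⇑D)^[m] a)
        rw [Derivation.leibniz_pow, smul_eq_mul, nsmul_eq_mul, Function.iterate_succ_apply']
        calc D ((⇑D)^[m] a) * (((m + 1 : ℕ) : R) * (lam ^ (m + 1 - 1) * D lam))
            = ((m + 1 : ℕ) : R) * lam ^ (m + 1 - 1) * (D lam * D ((⇑D)^[m] a)) := by ring
          _ = 0 := by rw [h0, mul_zero]
    rw [Function.iterate_succ_apply', ih, Derivation.smul_apply, smul_eq_mul, Derivation.leibniz,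
      smul_eq_mul, smul_eq_mul, hz, Function.iterate_succ_apply' (⇑D) n a]
    ring

end Rescale

/-! ### Step 3 — Lagrange projectors for an endomorphism `T` with `T ^ p = T` -/

section Projectors

variable {k : Type*} [Field k] (p : ℕ) [Fact p.Prime] [CharP k p]

/-- The nodes: the prime field `𝔽_p` inside `k` (the element `j mod p` of `k`). [folklore] -/
private def node (j : ZMod p) : k := ((j.val : ℕ) : k)

/-- The node `j ∈ 𝔽_p ⊂ k` is the canonical image of `j`. [folklore] -/
private theorem node_eq_castHom (j : ZMod p) :
    node (k := k) p j = ZMod.castHom (dvd_refl p) k j := by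
  rw [ZMod.castHom_apply, ZMod.cast_eq_val]; rfl

/-- The nodes are pairwise distinct. [folklore] -/
private theorem node_injective : Function.Injective (node (k := k) p) := by
  intro a b h
  rw [node_eq_castHom, node_eq_castHom] at h
  exact (ZMod.castHom (dvd_refl p) k).injective h

/-- Fermat: the nodes are roots of `X ^ p - X`. [folklore] -/
private theorem node_pow_card (j : ZMod p) : node (k := k) p j ^ p = node p j := by
  rw [node_eq_castHom, ← map_pow, ZMod.pow_card]

/-- `∏_{j ∈ 𝔽_p} (X - j) = X ^ p - X` in `k[X]`. [folklore] -/
private theorem nodal_univ_node_eq : Lagrange.nodal Finset.univ (node (k := k) p) = X ^ p - X := by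
  have hp : 1 < p := (Fact.out : p.Prime).one_lt
  have hlt : degree (X : k[X]) < degree ((X : k[X]) ^ p) := by
    rw [degree_X, degree_X_pow, Nat.one_lt_cast]; exact hp
  apply eq_of_degree_le_of_eval_index_eq (v := node (k := k) p) Finset.univ
    (node_injective p).injOn
  · rw [Lagrange.degree_nodal]
  · rw [degree_sub_eq_left_of_degree_lt hlt, Lagrange.degree_nodal, degree_X_pow,
      Finset.card_univ, ZMod.card]
  · rw [Lagrange.nodal_monic.leadingCoeff, leadingCoeff_sub_of_degree_lt hlt,
      (monic_X_pow p).leadingCoeff]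
  · intro i _
    rw [Lagrange.eval_nodal_at_node (Finset.mem_univ i), eval_sub, eval_pow, eval_X, node_pow_card,
      sub_self]

/-- `(X - j) · ℓ_j = w_j · (X ^ p - X)` for the Lagrange basis polynomial `ℓ_j` at the nodes `𝔽_p`.
[folklore] -/
private theorem X_sub_C_mul_basis (j : ZMod p) :
    (X - C (node (k := k) p j)) * Lagrange.basis Finset.univ (node (k := k) p) j =
      C (Lagrange.nodalWeight Finset.univ (node (k := k) p) j) * (X ^ p - X) := by
  classical
  rw [Lagrange.basis_eq_prod_sub_inv_mul_nodal_div (Finset.mem_univ j),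
    ← Lagrange.nodal_erase_eq_nodal_div (Finset.mem_univ j), mul_left_comm,
    ← Lagrange.nodal_eq_mul_nodal_erase (Finset.mem_univ j), nodal_univ_node_eq]

variable {M : Type*} [AddCommGroup M] [Module k M]

/-- The Lagrange projector `ℓ_j(T)` (the Lagrange basis polynomial at the node `j ∈ 𝔽_p`,
evaluated at `T`); for `T ^ p = T` it projects onto the `j`-eigenspace of `T`. [folklore] -/
private def proj (T : Module.End k M) (j : ZMod p) : Module.End k M :=
  aeval T (Lagrange.basis Finset.univ (node (k := k) p) j)

/-- The Lagrange projectors sum to the identity (`∑_j ℓ_j = 1`). [folklore] -/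
private theorem sum_proj (T : Module.End k M) : ∑ j, proj p T j = 1 := by
  simp only [proj]
  rw [← map_sum, Lagrange.sum_basis (node_injective p).injOn Finset.univ_nonempty, map_one]

/-- Pointwise form of `sum_proj`. [folklore] -/
private theorem sum_proj_apply (T : Module.End k M) (m : M) : ∑ j, proj p T j m = m := by
  have := congrArg (fun f : Module.End k M => f m) (sum_proj p T)
  simpa only [LinearMap.sum_apply, Module.End.one_apply] using this

/-- `T (ℓ_j(T) m) = j · ℓ_j(T) m` when `T ^ p = T`. [folklore] -/
private theorem apply_proj (T : Module.End k M) (hT : T ^ p = T) (j : ZMod p) (m : M) :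
    T (proj p T j m) = node (k := k) p j • proj p T j m := by
  have h := congrArg (fun q : k[X] => aeval T q m) (X_sub_C_mul_basis (k := k) p j)
  simp only [map_mul, map_sub, aeval_X, aeval_C, aeval_X_pow, hT, sub_self, mul_zero,
    LinearMap.zero_apply, Module.End.mul_apply, LinearMap.sub_apply,
    Module.algebraMap_end_apply] at h
  rw [proj]
  exact sub_eq_zero.mp h

omit [CharP k p] in
/-- If `T` maps the `k`-submodule `N` into itself, so does the projector `ℓ_j(T)` (a polynomial
in `T`). [folklore] -/
private theorem proj_apply_mem (T : Module.End k M) (N : Submodule k M) (hN : ∀ m ∈ N, T m ∈ N)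
    (j : ZMod p) {m : M} (hm : m ∈ N) : proj p T j m ∈ N := by
  rw [proj]
  induction Lagrange.basis Finset.univ (node (k := k) p) j using Polynomial.induction_on' with
  | add f g hf hg => rw [map_add, LinearMap.add_apply]; exact N.add_mem hf hg
  | monomial n c =>
    rw [aeval_monomial, Module.End.mul_apply, Module.algebraMap_end_apply]
    refine N.smul_mem c ?_
    induction n with
    | zero => simpa using hm
    | succ n ih => rw [pow_succ', Module.End.mul_apply]; exact hN _ ih

end Projectors

/-! ### Step 4 — assembling: eigen-coordinates forming a regular system of parameters -/

section Main

variable {k R : Type*} [Field k] [CommRing R] [Algebra k R]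

/-- **Normal form of a singular multiplicative derivation — root form** (OURS: the residue field
hypothesis of [cite: Posva2023, Prop. 4.1] is weakened from «`k` algebraically closed, residue field
`k`» to «the residue class of `u` is a `(p-1)`-st power of a non-zero scalar», which is exactly what
the printed proof uses). Let `R` be a complete regular local `k`-algebra, `char k = p`, `D` a
`k`-derivation of `R` which is *singular* (`D R ⊆ 𝔪`) and *multiplicative* (`D^[p] = u · D`,
`u ∈ Rˣ`), and assume `u ≡ c ^ (p - 1) (mod 𝔪)` for some `c ∈ kˣ`. Then there are `λ ∈ R` with
`λ ^ (p-1) · u = 1`, a regular system of parameters `x₁, …, x_d` of `R` (`(x₁,…,x_d) = 𝔪`,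
`d = dim R`) and weights `λ₁, …, λ_d ∈ 𝔽_p` with `λ · D xᵢ = λᵢ xᵢ` for all `i`, i.e.
`λD = ∑ᵢ λᵢ xᵢ ∂/∂xᵢ` in the formal coordinates `xᵢ`.
[cite: Posva2023, Prop. 4.1 p. 23 and its proof pp. 23–24] -/
theorem exists_regularParameters_eigen [IsRegularLocalRing R] [IsAdicComplete (maximalIdeal R) R]
    (p : ℕ) [Fact p.Prime] [CharP k p]
    (D : _root_.Derivation k R R) (hsing : ∀ a, D a ∈ maximalIdeal R)
    {u : R} (hu : IsUnit u) (hD : ∀ a, (⇑D)^[p] a = u * D a)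
    (hroot : ∃ c : k, c ≠ 0 ∧ u - algebraMap k R (c ^ (p - 1)) ∈ maximalIdeal R) :
    ∃ lam : R, lam ^ (p - 1) * u = 1 ∧
      ∃ (d : ℕ) (x : Fin d → R) (wt : Fin d → ZMod p),
        Ideal.span (Set.range x) = maximalIdeal R ∧ (d : WithBot ℕ∞) = ringKrullDim R ∧
          ∀ i, lam * D (x i) = ((wt i).val : R) * x i := by
  classical
  have hp : p.Prime := Fact.out
  haveI : CharP R p := charP_of_injective_algebraMap (algebraMap k R).injective p
  -- Step 1: `μ ^ (p-1) = u`, `λ := μ⁻¹`.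
  obtain ⟨c, hc0, hc⟩ := hroot
  have hunit : IsUnit ((p - 1 : ℕ) : R) := by
    have h : ((p - 1 : ℕ) : R) = -1 := by
      rw [Nat.cast_pred hp.pos, CharP.cast_eq_zero R p, zero_sub]
    rw [h]
    exact isUnit_one.neg
  obtain ⟨μ, hμ⟩ := exists_pow_eq_of_residue_pow (Nat.sub_pos_of_lt hp.one_lt) hunit hc0 hc
  have hμu : IsUnit μ := (isUnit_pow_iff (Nat.sub_ne_zero_of_lt hp.one_lt)).mp (hμ ▸ hu)
  obtain ⟨lam, hlamμ⟩ : ∃ lam : R, lam * μ = 1 := ⟨↑(hμu.unit⁻¹), hμu.val_inv_mul⟩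
  have hlam : lam ^ (p - 1) * u = 1 := by rw [← hμ, ← mul_pow, hlamμ, one_pow]
  have hlamu : IsUnit lam := IsUnit.of_mul_eq_one μ hlamμ
  refine ⟨lam, hlam, ?_⟩
  -- Step 2: `D' := λ • D` satisfies `D'^[p] = D'`.
  have hDu : ∀ a, D u * D a = 0 := apply_mul_apply_eq_zero_of_iterate_eq D hD
  have hDlam : ∀ b, D lam * D b = 0 := by
    intro b
    have h1 : D (lam ^ (p - 1) * u) = 0 := by rw [hlam, Derivation.map_one_eq_zero]
    rw [Derivation.leibniz, Derivation.leibniz_pow, smul_eq_mul, nsmul_eq_mul, smul_eq_mul] at h1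
    have h2 : (u * ((p - 1 : ℕ) : R) * lam ^ (p - 1 - 1)) * (D lam * D b) +
        lam ^ (p - 1) * (D u * D b) = 0 := by
      have := congrArg (· * D b) h1
      simp only [zero_mul] at this
      rw [← this]
      ring
    rw [hDu, mul_zero, add_zero] at h2
    exact ((hu.mul hunit).mul (hlamu.pow _)).mul_right_eq_zero.mp h2
  set D' : _root_.Derivation k R R := lam • D with hD'_def
  have hD'a : ∀ a, D' a = lam * D a := fun a => by
    rw [hD'_def, Derivation.smul_apply, smul_eq_mul]
  have hpow : lam ^ p = lam ^ (p - 1) * lam := by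
    rw [← pow_succ, Nat.sub_add_cancel hp.one_le]
  have hD'p : ∀ a, (⇑D')^[p] a = D' a := by
    intro a
    rw [hD'_def, iterate_smul_apply_of_apply_mul D hDlam, hD, ← mul_assoc, hpow,
      mul_assoc (lam ^ (p - 1)) lam u, mul_comm lam u, ← mul_assoc, hlam, one_mul,
      Derivation.smul_apply, smul_eq_mul]
  -- Step 3: the Lagrange projectors of `T := D'`.
  set T : Module.End k R := (D' : R →ₗ[k] R) with hT_def
  have hTa : ∀ a, T a = D' a := fun a => rfl
  have hT : T ^ p = T := by
    ext a
    rw [Module.End.pow_apply]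
    exact hD'p a
  have hPmem : ∀ (j : ZMod p) {a : R}, a ∈ maximalIdeal R → proj p T j a ∈ maximalIdeal R := by
    intro j a ha
    have := proj_apply_mem p T ((maximalIdeal R).restrictScalars k)
      (fun m _ => by
        rw [Submodule.restrictScalars_mem, hTa, hD'a]
        exact Ideal.mul_mem_left _ _ (hsing m)) j (m := a) (by rwa [Submodule.restrictScalars_mem])
    rwa [Submodule.restrictScalars_mem] at this
  have hPeig : ∀ (j : ZMod p) (a : R),
      lam * D (proj p T j a) = ((j.val : ℕ) : R) * proj p T j a := by
    intro j a
    have := apply_proj p T hT j a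
    rw [hTa, hD'a, Algebra.smul_def, node, map_natCast] at this
    exact this
  have hPsum : ∀ a : R, ∑ j, proj p T j a = a := sum_proj_apply p T
  -- Step 4: a basis of the cotangent space made of images of eigen-elements.
  set m := maximalIdeal R with hm_def
  obtain ⟨κ, ia, -, hspan, hli⟩ := exists_linearIndependent' (ResidueField R)
    (fun q : ZMod p × ↥m => m.toCotangent ⟨proj p T q.1 q.2, hPmem q.1 q.2.2⟩)
  have htop : Submodule.span (ResidueField R)
      (Set.range fun q : ZMod p × ↥m => m.toCotangent ⟨proj p T q.1 q.2, hPmem q.1 q.2.2⟩) = ⊤ := by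
    rw [eq_top_iff]
    rintro v -
    obtain ⟨b, rfl⟩ := m.toCotangent_surjective v
    have hb : b = ∑ j, (⟨proj p T j b, hPmem j b.2⟩ : ↥m) := by
      apply Subtype.ext
      rw [AddSubmonoidClass.coe_finsetSum]
      exact (hPsum b).symm
    rw [hb, map_sum]
    exact Submodule.sum_mem _ fun j _ => Submodule.subset_span ⟨(j, b), rfl⟩
  rw [htop] at hspan
  let B : Module.Basis κ (ResidueField R) (CotangentSpace R) := Module.Basis.mk hli hspan.ge
  haveI : Finite κ := Module.Finite.finite_basis B
  letI : Fintype κ := Fintype.ofFinite κ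
  have hd : Module.finrank (ResidueField R) (CotangentSpace R) = Fintype.card κ :=
    Module.finrank_eq_card_basis B
  set e : Fin (Fintype.card κ) ≃ κ := (Fintype.equivFin κ).symm with he
  refine ⟨Fintype.card κ, fun i => proj p T (ia (e i)).1 (ia (e i)).2, fun i => (ia (e i)).1,
    ?_, ?_, fun i => hPeig _ _⟩
  · -- the `x i` generate `𝔪`
    set x' : Fin (Fintype.card κ) → ↥m := fun i => ⟨proj p T (ia (e i)).1 (ia (e i)).2,
      hPmem _ (ia (e i)).2.2⟩ with hx'
    have hsp : Submodule.span (ResidueField R) (m.toCotangent '' Set.range x') = ⊤ := by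
      rw [← Set.range_comp]
      have : (⇑m.toCotangent) ∘ x' =
          ((fun q : ZMod p × ↥m => m.toCotangent ⟨proj p T q.1 q.2, hPmem q.1 q.2.2⟩) ∘ ia) ∘ e :=
        rfl
      rw [this, e.surjective.range_comp]
      exact hspan
    have h1 := IsLocalRing.CotangentSpace.span_image_eq_top_iff.mp hsp
    have h2 := congrArg (Submodule.map m.subtype) h1
    rw [Submodule.map_span, Submodule.map_top, Submodule.range_subtype, ← Set.range_comp] at h2
    exact h2
  · rw [← hd]
    exact (IsRegularLocalRing.iff_finrank_cotangentSpace R).mp inferInstance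

end Main

end MultiplicativeNormalForm

/-! ### The named statement (source's hypotheses) and its proof -/

universe u v

/-- **Posva, Nagoya Math. J. 261 (2026) e6, Proposition 4.1** (normal form of a multiplicative
derivation of a regular local ring), typed in the precise form its printed proof establishes (see
the module docstring: normal form for `λD`, `λ = u^{1/(1-p)}`; hypotheses `k` algebraically closed
of characteristic `p`, `A` a complete regular local `k`-algebra with residue field `k`, `D` singular
(arXiv v5) and multiplicative, `D^[p] = u·D`, `u ∈ Aˣ`, Def. 2.5 p. 7). Printed (p. 23): «Suppose
that A a regular local k-algebra. If D ∈ Der_k(A) is multiplicative then there exist formal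
coordinates x₁, …, x_d ∈ Â and λ₁, …, λ_d ∈ 𝔽_p such that D = ∑ᵢ λᵢ xᵢ ∂/∂xᵢ.» Typed conclusion:
there are `λ ∈ A` with `λ^(p-1) u = 1`, a regular system of parameters `x : Fin d → A`
(`(x₁,…,x_d) = 𝔪_A`, `d = dim A`) and weights `λᵢ ∈ 𝔽_p` (`ZMod p`, cast through `ℕ`) with
`λ · D xᵢ = λᵢ xᵢ` for all `i`. The clause «In particular, the completion of A^D is normal toric» is
not typed. Discharged below (`Posva2023_Prop_4_1_holds`); the root form with weaker residue-field
hypothesis is `MultiplicativeNormalForm.exists_regularParameters_eigen`.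
[cite: Posva2023, Prop. 4.1 p. 23 (proof pp. 23–24); arXiv:2311.16694v5 Prop. 4.1.1 p. 20] -/
def Posva2023_Prop_4_1 : Prop :=
  ∀ (p : ℕ) [Fact p.Prime] (k : Type u) [Field k] [CharP k p] [IsAlgClosed k]
    (A : Type v) [CommRing A] [Algebra k A] [IsRegularLocalRing A]
    [IsAdicComplete (maximalIdeal A) A],
    (∀ b : A, ∃ c : k, b - algebraMap k A c ∈ maximalIdeal A) →
    ∀ (D : _root_.Derivation k A A), (∀ a, D a ∈ maximalIdeal A) →
    ∀ (u : A), IsUnit u → (∀ a, (⇑D)^[p] a = u * D a) →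
      ∃ lam : A, lam ^ (p - 1) * u = 1 ∧
        ∃ (d : ℕ) (x : Fin d → A) (wt : Fin d → ZMod p),
          Ideal.span (Set.range x) = maximalIdeal A ∧ (d : WithBot ℕ∞) = ringKrullDim A ∧
            ∀ i, lam * D (x i) = ((wt i).val : A) * x i

/-- Proof of `Posva2023_Prop_4_1`: for `k` algebraically closed and residue field `k`, the residue
of the unit `u` is a `(p-1)`-st power of a non-zero scalar, so the root form
`MultiplicativeNormalForm.exists_regularParameters_eigen` applies.
[cite: Posva2023, Prop. 4.1 p. 23, proof pp. 23–24] -/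
theorem Posva2023_Prop_4_1_holds : Posva2023_Prop_4_1 := by
  intro p _ k _ _ _ A _ _ _ _ hres D hsing u hu hD
  have hp : p.Prime := Fact.out
  obtain ⟨c₀, hc₀⟩ := hres u
  have hc₀0 : c₀ ≠ 0 := by
    rintro rfl
    rw [map_zero, sub_zero] at hc₀
    exact (IsLocalRing.mem_maximalIdeal _).mp hc₀ hu
  obtain ⟨c, hc⟩ := IsAlgClosed.exists_pow_nat_eq c₀ (Nat.sub_pos_of_lt hp.one_lt)
  have hc0 : c ≠ 0 := by
    rintro rfl
    rw [zero_pow (Nat.sub_ne_zero_of_lt hp.one_lt)] at hc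
    exact hc₀0 hc.symm
  exact MultiplicativeNormalForm.exists_regularParameters_eigen p D hsing hu hD
    ⟨c, hc0, by rwa [hc]⟩

end Literature.RingTheory.Derivation
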